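import Mathlib

/-!
# Block H (d ≥ 11) — abstract glue lemmas (seat p3, blind cell pub-perc-repro0)

Kernel-checked abstract forms of H2 · SQUARE-SUM, H4 · THETA-SQUARED and H3 · HIGH-D-ASSEMBLY of
`proofs/HIGHD-p3-v2.md` (route/ROUTE-v3.md §2.4), stated for an arbitrary index type (to be the
vertex set `ℤ^d`) and an arbitrary probability measure (to be `P_p`), so that they can be
instantiated on the cell's `Statement.lean` definitions once those land. They contain exactly the
glue of the paper proof:

* `summable_sq_of_summable_triangle` — H2(i): the terms `(x, o)` of the triangle diagram give
  `∑_x τ(o,x)² ≤ ∇`;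
* `finite_ge_of_summable` — H2(ii): a summable family has only finitely many terms `≥ ε`;
* `sq_le_measure_of_inclusion` — H4: `P(A ∩ B ∩ U) ⊆ C`, `P(Uᶜ) = 0`, Harris `P(A)P(B) ≤ P(A ∩ B)`
  and `P(B) = P(A)` give `P(A)² ≤ P(C)`;
* `eq_zero_of_sq_le_of_summable`, `eq_zero_of_sq_le_of_summable_triangle` — H3: on an infinite
  index set, `θ² ≤ τ(o,x)` for all `x` and a finite triangle diagram force `θ = 0`.
-/

namespace Summit.Ventures.PercRepro0.HighD

open Filter Topology MeasureTheory

/-- H2(i), abstract. If the triangle diagram `∑_{x,y} τ o x · τ x y · τ y o` is summable then so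
is `∑_x τ o x ^ 2`: keep only the terms with `y = o` and use `τ o o = 1`, `τ x o = τ o x`. -/
theorem summable_sq_of_summable_triangle {ι : Type*} (τ : ι → ι → ℝ) (o : ι)
    (h_refl : τ o o = 1) (h_symm : ∀ x, τ x o = τ o x)
    (h : Summable (fun p : ι × ι => τ o p.1 * τ p.1 p.2 * τ p.2 o)) :
    Summable (fun x : ι => τ o x ^ 2) := by
  have h1 : Summable ((fun p : ι × ι => τ o p.1 * τ p.1 p.2 * τ p.2 o) ∘ (fun x : ι => (x, o))) :=
    h.comp_injective (fun a b hab => (Prod.mk.inj hab).1)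
  refine h1.congr ?_
  intro x
  simp only [Function.comp]
  rw [h_refl, h_symm x]
  ring

/-- H2(ii), abstract: a summable real family has only finitely many terms `≥ ε` (`ε > 0`). -/
theorem finite_ge_of_summable {ι : Type*} (a : ι → ℝ) (ha : Summable a) {ε : ℝ} (hε : 0 < ε) :
    {x : ι | ε ≤ a x}.Finite := by
  have h2 : ∀ᶠ x in cofinite, a x < ε := ha.tendsto_cofinite_zero.eventually (eventually_lt_nhds hε)
  rw [Filter.eventually_cofinite] at h2
  exact h2.subset (fun x hx => not_lt.mpr hx)

/-- H3, abstract core: on an infinite index set, `θ² ≤ a x` for every `x` and `a` summable force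
`θ = 0` (otherwise infinitely many terms would be `≥ θ² > 0`). -/
theorem eq_zero_of_sq_le_of_summable {ι : Type*} [Infinite ι] (a : ι → ℝ) (ha : Summable a)
    (θ : ℝ) (hθ : ∀ x, θ ^ 2 ≤ a x) : θ = 0 := by
  by_contra hne
  have hpos : 0 < θ ^ 2 := by positivity
  have hfin := finite_ge_of_summable a ha hpos
  have huniv : {x : ι | θ ^ 2 ≤ a x} = Set.univ := Set.eq_univ_of_forall hθ
  rw [huniv] at hfin
  exact Set.infinite_univ hfin

/-- H4, abstract. For a probability measure: if `A ∩ B ∩ U ⊆ C`, `μ Uᶜ = 0` (uniqueness),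
`μ A * μ B ≤ μ (A ∩ B)` (Harris) and `μ B = μ A` (translation invariance), then `μ A ^ 2 ≤ μ C`. -/
theorem sq_le_measure_of_inclusion {Ω : Type*} [MeasurableSpace Ω] (μ : Measure Ω)
    (A B U C : Set Ω) (hU : μ Uᶜ = 0) (hsub : A ∩ B ∩ U ⊆ C)
    (hfkg : μ A * μ B ≤ μ (A ∩ B)) (hBA : μ B = μ A) : μ A ^ 2 ≤ μ C := by
  have hsplit : μ (A ∩ B) ≤ μ (A ∩ B ∩ U) + μ Uᶜ := by
    calc μ (A ∩ B) ≤ μ ((A ∩ B) ∩ U ∪ (A ∩ B) ∩ Uᶜ) := by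
          apply measure_mono
          intro x hx
          by_cases hxU : x ∈ U
          · exact Or.inl ⟨hx, hxU⟩
          · exact Or.inr ⟨hx, hxU⟩
      _ ≤ μ ((A ∩ B) ∩ U) + μ ((A ∩ B) ∩ Uᶜ) := measure_union_le _ _
      _ ≤ μ (A ∩ B ∩ U) + μ Uᶜ :=
          add_le_add le_rfl (measure_mono Set.inter_subset_right)
  calc μ A ^ 2 = μ A * μ B := by rw [hBA, sq]
    _ ≤ μ (A ∩ B) := hfkg
    _ ≤ μ (A ∩ B ∩ U) + μ Uᶜ := hsplit
    _ = μ (A ∩ B ∩ U) := by rw [hU, add_zero]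
    _ ≤ μ C := measure_mono hsub

/-- H3 · HIGH-D-ASSEMBLY, abstract: a finite triangle diagram (H2) and `θ² ≤ τ o x` for all `x`
(H4) on an infinite vertex set force `θ = 0`. -/
theorem eq_zero_of_sq_le_of_summable_triangle {ι : Type*} [Infinite ι] (τ : ι → ι → ℝ) (o : ι)
    (h_refl : τ o o = 1) (h_symm : ∀ x, τ x o = τ o x)
    (h_tri : Summable (fun p : ι × ι => τ o p.1 * τ p.1 p.2 * τ p.2 o))
    (θ : ℝ) (hθ : ∀ x, θ ^ 2 ≤ τ o x) : θ = 0 := by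
  have hsq := summable_sq_of_summable_triangle τ o h_refl h_symm h_tri
  have h4 : ∀ x, (θ ^ 2) ^ 2 ≤ τ o x ^ 2 := fun x => by
    have hx := hθ x
    gcongr
  have h2 : θ ^ 2 = 0 := eq_zero_of_sq_le_of_summable (fun x => τ o x ^ 2) hsq (θ ^ 2) h4
  exact pow_eq_zero_iff (n := 2) (by norm_num) |>.mp h2

end Summit.Ventures.PercRepro0.HighD
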